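import Literature.MathematicalPhysics.QuantumFieldTheory.Balaban1983to89.B1Prop23RegularRegion
import Literature.MathematicalPhysics.QuantumFieldTheory.Balaban1983to89.B1Ineq229RegularRegion
import Literature.MathematicalPhysics.QuantumFieldTheory.Balaban1983to89.B1

/-!
# `Balaban1983to89.B1Prop22RegularRegionFam` — T. Bałaban, *(Higgs)₂,₃ quantum fields in a finite volume. I. A lower bound*,
# Commun. Math. Phys. **85** (1982) 603–626 [Balaban1982Higgs1], PROPOSITION 2.2 (2.27)–(2.29) p. 611: **THE TYPED STATEMENT
# `B1.Prop22Small` (intended reading, smallness «for e(L^kε) sufficiently small» inherited from Prop. 2.1) INHABITED BY THE CONCRETE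
# (Higgs)₂,₃ CARRIER AT EVERY (2.23)-REGULAR `A ≠ 0` FOR NESTED REGIONS `Ω = B^k(Λ_k) ⊆ Ω₀ = B^k(Λ⁰_k) ⊆ T_ε`** — the family of
# `B1.DeltaSetting`s indexed by (torus, level, `Λ_k ⊆ Λ⁰_k`, vector field `A`, effective coupling `e_k`), with `regular` := (2.23) on `Ω₀`
# bond by bond, `kerD`/`kerDD0` := the kernels of `Δ^{(k),L^kε}(Ω,A)` and `δΔ^{(k),L^kε}(Ω,Ω₀,A)` RESCALED TO THE UNIT LATTICE (factor
# `(L^kε)²`, (2.22)), fed by r14 g14's `B1Prop23RegularRegion.ineq227_regular_region_uniform` and `B1Ineq229RegularRegion.ineq229_regular_region_distC`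

statement-level skeleton of published theorems with citation tags; proofs where landed; nothing here is a claim about the Yang–Mills mass gap

PDF held: `paper:balaban1982-cmp85-higgs23-i` (journal page = PDF page + 602), p. 611 [PDF 9] Prop. 2.2 (2.27)–(2.29), p. 610 [PDF 8]
(2.22)–(2.23) (OCR `p0008.txt`/`p0009.txt` re-read by this seat).

CITATION HEADER (lean-in-tree rule).  Cell `lit-balaban` (HOME `run/shared/lean/pub/lit-balaban/`), reader/typer seat **r14** gen 14
(unit `lit-balaban-r14`, B1 fold owner; TAKING line HOME/STATUS.md 2026-08-22T07:18:39Z).  SKELETON row **B1.Prop2.2**: decls of record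
`B1.Prop22Literal` / `B1.Prop22Small` (pv07's typed statement over the abstract carrier `B1.DeltaSetting`); head «proved …» by p17's
b04-carrier instance.  THIS file: the typed `B1.Prop22Small` INHABITED BY A FAMILY BUILT FROM THE CONCRETE (Higgs)₂,₃ CARRIER at every
(2.23)-regular `A` — a MODEL INSTANCE on the cell's own carrier, not a new reading.
USED BY NAME, never restated: pv07 `B1.{DeltaSetting, Ineq227_229, Prop22Small}`, r14 g14 `B1Prop23RegularRegion.ineq227_regular_region_uniform`,
`B1Ineq229RegularRegion.ineq229_regular_region_distC`, `B1Ineq18RegularRegion.gammaReg_pos`, r14 g12 `B1Ineq229ZeroFieldRegion.subset_of_iff`,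
r14 g7 `B1Ineq234Concrete.{distC, distC_nonneg}`, typer `B1Eq230FluctCov.{mat, deltaKA}`, `B2Ineq329ZeroAveraging.mesh_eq`.

WHAT IS PRINTED (verbatim, [B1] p. 611 [PDF 9], OCR `p0009.txt` l. 8–15): *"Proposition 2.2. If a configuration A is regular in the same
sense as in Proposition 2.1 then there exist constants δ₀ > 0 and c₀, depending on the same quantities as in Proposition 2.1, such that
|Δ^{(k)}(Ω, A; x, x′)| ≦ c₀exp(−δ₀|x − x′|), x, x′ ∈ Ω^{(k)}_1 (2.27) Putting for Ω ⊂ Ω₀  δΔ^{(k)}(Ω, Ω₀, A) = Δ^{(k)}(Ω, A) − Δ^{(k)}(Ω₀, A),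
(2.28) the following inequality holds |δΔ^{(k)}(Ω, Ω₀, A; x, x′)| ≦ c₀exp(−δ₀(|x − x′| + dist(x, Ω^{(k)c}) + dist(x′, Ω^{(k)c}))). (2.29)"*;
p. 610 (2.23): *"|(∂^η_μA_ν)(x)| ≦ c(e(L^kε))^{β−1}, x ∈ Ω"*, *"for e(L^kε) sufficiently small"*.

THE FAMILY (dictionary of each field of `B1.DeltaSetting`).  Index `i` = a torus `P` of the carrier with `P.d = d`, `P.L = L`; a level
`k = j + 1 ≤ K_P`; block-site sets `Λ_k ⊆ Λ⁰_k ⊂ T^{(k)}` (`Ω = B^k(Λ_k)`, `Ω₀ = B^k(Λ⁰_k)`); a vector field `A` on `T_ε`; the effective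
coupling `e_k > 0` of (2.23).  `KSite` := the coordinate indices `(x, i)`, `x ∈ Λ_k` (the print's «x, x′ ∈ Ω^{(k)}» with the component
index of `ℝ^N`); `e := e_k`; `regular` := (2.23) ON `Ω₀`, bond by bond, in p35's rescaled form `(L^kε|e|/e_k)·|A_μ(z + εe_ν) − A_μ(z)| ≦
c·e_k^{β−1}/L^k` (`c ≥ 0`, `β > 0` family parameters); `bigBlocks := True` (NOT NEEDED by the Combes–Thomas route — we prove MORE than the
print asks); `udist` := the distance (1.3) of `T^{(k)}`; `distOc := dist(·, Λ_kᶜ)` (`distC`); `kerD (x,i) (x′,i′) := (L^kε)²·|Δ^{(k),L^kε}(Ω,A)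
((x,i),(x′,i′))|` and `kerDD0 := (L^kε)²·|(Δ^{(k),L^kε}(Ω,A) − Δ^{(k),L^kε}(Ω₀,A))((x,i),(x′,i′))|` — the kernels *"rescaled to the unit lattice"*
((2.22): the operator `Δ^{(k)}` of (2.27) is `(L^kε)²Δ^{(k),L^kε}` entrywise).  Family parameters: `d, L, N`, the charge data `C`, `a`, `m²`,
`c`, `β`.

WHAT THIS FILE PROVES (kernel-checked, zero `sorry`; axioms standard).
* `RegRegionIdx`, `RegRegionIdx.Omega`/`Omega0` (+ `mem_Omega`/`mem_Omega0`), **`regRegionFam`** (the family, all fields with bodies);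
  `exists_deltaA_of_reg223` (the (2.23) currency ⇒ r14 g14's `(δ_A, d²·ε|e|·L^{2k}·δ_A ≤ 1/3)` currency, `e = 0` included).
* **`prop22Small_regRegionFam`**: for `d`, `L > 1`, `N`, `C`, `a > 0`, `m² > 0`, `c ≥ 0`, `β > 0`: `B1.Prop22Small (regRegionFam d L C a m² c β)`
  — with `δ₀ = γ₀/(2(4d + 4a))`, `c₀ = (a + a²(2/γ₀)e^{2δ₀}) + a²·½(K₁ + K₂)`, `e₁ = (3(d²c + 1))^{−1/β}`, `γ₀ = min{2, a(1 − L⁻²)/4}` — constants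
  depending on `d, L, a, c, β` only (the print: «the same quantities as in Proposition 2.1»: `d, α, M`).
* `regRegionFam_nonvacuous`: members with `regular ∧ 0 < e ≤ e₁` exist for every `e₁ > 0` (`A = 0`).
HONEST SCOPE.  (i) A MODEL INSTANCE of the typed statement on the concrete carrier (every torus, level, nested pair of block unions, every
regular `A`), constants depending on `(d, L, a, c, β)`; (ii) the kernels are indexed by coordinate pairs `(x, i)` — for the `ℝ^N`-matrix entries
of the print this is the entrywise bound; (iii) `bigBlocks := True` and `Λ_k ⊆ Λ⁰_k` arbitrary: stronger than printed; (iv) METHOD as in the two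
input files (Combes–Thomas + energy comparison, not the random walk); (v) NOT summit progress.
-/

noncomputable section

open scoped BigOperators InnerProductSpace Matrix

namespace Literature.MathematicalPhysics.QuantumFieldTheory.Balaban1983to89.B1Prop22RegularRegionFam

open HiggsLattice HiggsAveraging HiggsCovariance HiggsCovariancePos B1Eq230FluctCov
open B1Ineq234Concrete (distC distC_nonneg)
open B1Ineq18RegularRegion (gammaReg_pos)
open B1Prop23RegularRegion (ineq227_regular_region_uniform)
open B1Ineq229RegularRegion (ineq229_regular_region_distC)
open B1Ineq229ZeroFieldRegion (subset_of_iff)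
open B2Ineq329ZeroAveraging (mesh_eq)
open Matrix

variable {N : ℕ}

/-! ## §1 The index set and the family -/

/-- An index of the family: a torus of the carrier with `P.d = d`, `P.L = L`, a level `k = j + 1 ≤ K_P`, nested block-site sets
`Λ_k ⊆ Λ⁰_k ⊂ T^{(k)}`, a vector field `A` on the bonds of `T_ε`, an effective coupling `e_k`. [cite: Balaban1982Higgs1, Prop. 2.2 p.611, (2.23) p.610] -/
structure RegRegionIdx (d L : ℕ) where
  /-- the torus of the carrier -/
  P : HiggsLattice.Params
  hPd : P.d = d
  hPL : P.L = L
  /-- the level is `k = j + 1` -/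
  j : ℕ
  hk : j + 1 ≤ P.K
  /-- `Ω^{(k)} = Λ_k ⊆ Ω₀^{(k)} = Λ⁰_k` -/
  Λk : Finset (HiggsLattice.Site P (j + 1))
  Λ0k : Finset (HiggsLattice.Site P (j + 1))
  hsub : Λk ⊆ Λ0k
  /-- the vector field on the bonds of `T_ε` -/
  A : HiggsLattice.VecField P 0
  /-- the effective coupling `e_k` -/
  ec : ℝ

variable {d L : ℕ}

namespace RegRegionIdx

variable (i : RegRegionIdx d L)

open Classical in
/-- `Ω = B^k(Λ_k) ⊂ T_ε`. [cite: Balaban1982Higgs1, (1.18) p.607, Prop. 2.1 «Ω = B^k(Ω^{(k)})» p.610] -/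
def Omega : Finset (HiggsLattice.Site i.P 0) := Finset.univ.filter fun x => blockIter (i.j + 1) x ∈ i.Λk

open Classical in
/-- `Ω₀ = B^k(Λ⁰_k) ⊂ T_ε`. [cite: Balaban1982Higgs1, (1.18) p.607, (2.28) p.611] -/
def Omega0 : Finset (HiggsLattice.Site i.P 0) := Finset.univ.filter fun x => blockIter (i.j + 1) x ∈ i.Λ0k

/-- membership in `Ω`. [cite: Balaban1982Higgs1, (1.18) p.607] -/
theorem mem_Omega (x : HiggsLattice.Site i.P 0) : x ∈ i.Omega ↔ blockIter (i.j + 1) x ∈ i.Λk := by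
  simp [Omega]

/-- membership in `Ω₀`. [cite: Balaban1982Higgs1, (1.18) p.607] -/
theorem mem_Omega0 (x : HiggsLattice.Site i.P 0) : x ∈ i.Omega0 ↔ blockIter (i.j + 1) x ∈ i.Λ0k := by
  simp [Omega0]

end RegRegionIdx

/-- **THE FAMILY OF SETTINGS OF PROP. 2.2 BUILT FROM THE (Higgs)₂,₃ CARRIER AT EVERY (2.23)-REGULAR FIELD, NESTED REGIONS** (module docstring
«THE FAMILY» for the reading of each field). [cite: Balaban1982Higgs1, Prop. 2.2 (2.27)–(2.29) p.611; (2.21)–(2.23) p.610] -/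
def regRegionFam (d L : ℕ) (C : ChargeData N) (a msq c β : ℝ) (i : RegRegionIdx d L) : B1.DeltaSetting where
  KSite := {p : HiggsLattice.Site i.P (i.j + 1) × Ix N // p.1 ∈ i.Λk}
  e := i.ec
  regular := ∀ z ∈ i.Omega0, ∀ μ ν : Fin i.P.d,
    i.P.mesh (i.j + 1) * |C.e| / i.ec * |i.A ⟨z.shift ν, μ⟩ - i.A ⟨z, μ⟩| ≤ c * i.ec ^ (β - 1) / (i.P.L : ℝ) ^ (i.j + 1)
  bigBlocks := True
  udist := fun p q => (HiggsLattice.Site.tdist p.1.1 q.1.1 : ℝ)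
  distOc := fun p => distC i.Λk p.1.1
  kerD := fun p q => i.P.mesh (i.j + 1) ^ 2 * |mat (deltaKA C i.Omega i.A msq a (i.j + 1)) p.1 q.1|
  kerDD0 := fun p q => i.P.mesh (i.j + 1) ^ 2 *
    |mat (deltaKA C i.Omega i.A msq a (i.j + 1)) p.1 q.1 - mat (deltaKA C i.Omega0 i.A msq a (i.j + 1)) p.1 q.1|

/-! ## §2 The (2.23) currency implies r14 g14's `δ_A`-currency -/

/-- **From (2.23) bond by bond to a uniform bound on the one-step differences with the Cor.-2.3 smallness**: if
`(L^kε|e|/e_k)·|A_μ(z + εe_ν) − A_μ(z)| ≤ c·e_k^{β−1}/L^k` at the sites of `S` (`e_k > 0`, `c ≥ 0`) and `d²·c·e_k^β ≤ 1/3`, then there is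
`δ_A` with `|A_μ(z + εe_ν) − A_μ(z)| ≤ δ_A` on `S` and `d²·ε|e|·L^{2k}·δ_A ≤ 1/3` (`e = 0` included: then the smallness is free).
[cite: Balaban1982Higgs1, Prop. 2.1 (2.23) p.610] -/
theorem exists_deltaA_of_reg223 {P : HiggsLattice.Params} (C : ChargeData N) {k : ℕ} (S : Finset (HiggsLattice.Site P 0))
    (A : HiggsLattice.VecField P 0) {creg β ec : ℝ} (hec : 0 < ec)
    (hreg : ∀ z ∈ S, ∀ μ ν : Fin P.d,
      P.mesh k * |C.e| / ec * |A ⟨z.shift ν, μ⟩ - A ⟨z, μ⟩| ≤ creg * ec ^ (β - 1) / (P.L : ℝ) ^ k)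
    (hsmall : (P.d : ℝ) ^ 2 * creg * ec ^ β ≤ 1 / 3) :
    ∃ δA : ℝ, (∀ z ∈ S, ∀ μ ν : Fin P.d, |A ⟨z.shift ν, μ⟩ - A ⟨z, μ⟩| ≤ δA) ∧
      (P.d : ℝ) ^ 2 * (P.mesh 0 * |C.e|) * ((P.L : ℝ) ^ k) ^ 2 * δA ≤ 1 / 3 := by
  classical
  have hm : 0 < P.mesh 0 := P.mesh_pos 0
  have hmk : 0 < P.mesh k := P.mesh_pos k
  have hLk : (0 : ℝ) < (P.L : ℝ) ^ k := pow_pos (by exact_mod_cast P.hL) k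
  have hmesh : P.mesh k = (P.L : ℝ) ^ k * P.mesh 0 := mesh_eq k
  by_cases he : C.e = 0
  · refine ⟨∑ z ∈ S, ∑ μ : Fin P.d, ∑ ν : Fin P.d, |A ⟨z.shift ν, μ⟩ - A ⟨z, μ⟩|, ?_, ?_⟩
    · intro z hz μ ν
      refine le_trans ?_ (Finset.single_le_sum (f := fun z' => ∑ μ' : Fin P.d, ∑ ν' : Fin P.d,
        |A ⟨HiggsLattice.Site.shift z' ν', μ'⟩ - A ⟨z', μ'⟩|)
        (fun z' _ => Finset.sum_nonneg fun _ _ => Finset.sum_nonneg fun _ _ => abs_nonneg _) hz)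
      refine le_trans ?_ (Finset.single_le_sum (f := fun μ' : Fin P.d => ∑ ν' : Fin P.d,
        |A ⟨HiggsLattice.Site.shift z ν', μ'⟩ - A ⟨z, μ'⟩|)
        (fun _ _ => Finset.sum_nonneg fun _ _ => abs_nonneg _) (Finset.mem_univ μ))
      exact Finset.single_le_sum (f := fun ν' : Fin P.d => |A ⟨HiggsLattice.Site.shift z ν', μ⟩ - A ⟨z, μ⟩|)
        (fun _ _ => abs_nonneg _) (Finset.mem_univ ν)
    · rw [he, abs_zero, mul_zero]
      norm_num
  · have hepos : 0 < |C.e| := abs_pos.mpr he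
    have hden : 0 < (P.L : ℝ) ^ k * (P.mesh k * |C.e|) := by positivity
    refine ⟨creg * ec ^ β / ((P.L : ℝ) ^ k * (P.mesh k * |C.e|)), ?_, ?_⟩
    · intro z hz μ ν
      have h := hreg z hz μ ν
      have hpow : ec ^ (β - 1) * ec = ec ^ β := by
        rw [Real.rpow_sub_one hec.ne', div_mul_cancel₀ _ hec.ne']
      have hcoef : 0 < P.mesh k * |C.e| / ec := by positivity
      have h1 : |A ⟨z.shift ν, μ⟩ - A ⟨z, μ⟩| ≤ (creg * ec ^ (β - 1) / (P.L : ℝ) ^ k) / (P.mesh k * |C.e| / ec) := by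
        rw [le_div_iff₀ hcoef, mul_comm]; exact h
      refine h1.trans (le_of_eq ?_)
      rw [← hpow]
      field_simp
    · rw [hmesh]
      have e : (P.d : ℝ) ^ 2 * (P.mesh 0 * |C.e|) * ((P.L : ℝ) ^ k) ^ 2 *
          (creg * ec ^ β / ((P.L : ℝ) ^ k * ((P.L : ℝ) ^ k * P.mesh 0 * |C.e|)))
          = (P.d : ℝ) ^ 2 * creg * ec ^ β := by
        field_simp
      rw [e]
      exact hsmall

/-! ## §3 The typed statement `B1.Prop22Small` on the family -/

/-- exponential weights compare: `c ≦ c′`, `δ′ ≦ δ`, `s ≧ 0` ⇒ `c·e^{−δs} ≦ c′·e^{−δ′s}`. [folklore] -/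
private theorem weight_mono {c c' δ δ' s : ℝ} (hc : c ≤ c') (hc' : 0 ≤ c') (hδ : δ' ≤ δ) (hs : 0 ≤ s) :
    c * Real.exp (-(δ * s)) ≤ c' * Real.exp (-(δ' * s)) := by
  have h1 : Real.exp (-(δ * s)) ≤ Real.exp (-(δ' * s)) := Real.exp_le_exp.2 (by nlinarith)
  exact (mul_le_mul_of_nonneg_right hc (Real.exp_nonneg _)).trans (mul_le_mul_of_nonneg_left h1 hc')

/-- **[B1] PROPOSITION 2.2 IN ITS TYPED INTENDED READING `B1.Prop22Small` HOLDS ON THE CARRIER FAMILY `regRegionFam`**: for `d`, `L > 1`,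
`N`, charge data `C`, `a > 0`, `m² > 0`, `c ≥ 0`, `β > 0` there are `δ₀, c₀, e₁ > 0` such that EVERY member (torus with these `d, L`, level
`k`, nested `Λ_k ⊆ Λ⁰_k`, field `A`, coupling `e_k`) which is (2.23)-regular on `Ω₀` with `0 < e_k ≤ e₁` satisfies (2.27) and (2.29) for the
unit-lattice kernels with these constants: `δ₀ = γ₀/(2(4d + 4a))`, `c₀ = (a + a²(2/γ₀)e^{2δ₀}) + a²·½(e^{12δ₀}((d + a/2)(2/γ₀)² + γ₀⁻¹) +
(4/γ₀)e^{2δ₀})`, `e₁ = (3(d²c + 1))^{−1/β}`, `γ₀ = min{2, a(1 − L⁻²)/4}`.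
[cite: Balaban1982Higgs1, Prop. 2.2 (2.27)–(2.29) p.611, Prop. 2.1 (2.23) p.610] -/
theorem prop22Small_regRegionFam (d L : ℕ) (hL : 1 < L) (C : ChargeData N) {a msq : ℝ} (ha : 0 < a) (hmsq : 0 < msq)
    {c : ℝ} (hc : 0 ≤ c) {β : ℝ} (hβ : 0 < β) :
    B1.Prop22Small (regRegionFam d L C a msq c β) := by
  have hLr : (1 : ℝ) < (L : ℝ) := by exact_mod_cast hL
  have hinv : ((L : ℝ) ^ 2)⁻¹ < 1 := inv_lt_one_of_one_lt₀ (by nlinarith)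
  have hγ : 0 < min 2 (a * (1 - ((L : ℝ) ^ 2)⁻¹) / 4) :=
    lt_min (by norm_num) (by nlinarith [mul_pos ha (show (0:ℝ) < 1 - ((L : ℝ) ^ 2)⁻¹ by linarith)])
  have hden : (0 : ℝ) < 4 * d + 4 * a := by positivity
  -- the admissible exponent and the two kernel constants
  obtain ⟨δa, hδa⟩ : ∃ δa : ℝ, δa = min 2 (a * (1 - ((L : ℝ) ^ 2)⁻¹) / 4) / (4 * d + 4 * a) := ⟨_, rfl⟩
  have hδapos : 0 < δa := by rw [hδa]; exact div_pos hγ hden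
  obtain ⟨c27, hc27⟩ : ∃ c27 : ℝ, c27 = a + a ^ 2 * (2 / min 2 (a * (1 - ((L : ℝ) ^ 2)⁻¹) / 4) * Real.exp δa) := ⟨_, rfl⟩
  have hc27pos : 0 < c27 := by rw [hc27]; positivity
  obtain ⟨cL, hcL⟩ : ∃ cL : ℝ, cL = a ^ 2 * ((Real.exp (6 * δa) * ((d + a / 2) * (2 / min 2 (a * (1 - ((L : ℝ) ^ 2)⁻¹) / 4)) ^ 2
      + (min 2 (a * (1 - ((L : ℝ) ^ 2)⁻¹) / 4))⁻¹) + 4 / min 2 (a * (1 - ((L : ℝ) ^ 2)⁻¹) / 4) * Real.exp δa) / 2) := ⟨_, rfl⟩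
  have hcLnn : 0 ≤ cL := by rw [hcL]; positivity
  -- the coupling threshold `e₁ = (3(d²c + 1))^{−1/β}`
  obtain ⟨E₁, hE₁⟩ : ∃ E₁ : ℝ, E₁ = 1 / (3 * ((d : ℝ) ^ 2 * c + 1)) := ⟨_, rfl⟩
  have hE₁pos : 0 < E₁ := by rw [hE₁]; positivity
  refine ⟨δa / 2, c27 + cL, E₁ ^ (1 / β), by positivity, by linarith, Real.rpow_pos_of_pos hE₁pos _, ?_⟩
  intro i hregular _ hepos hele
  obtain ⟨P, hPd, hPL, j, hk, Λk, Λ0k, hsub, A, ec⟩ := i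
  subst hPd hPL
  have hPL1 : 1 < P.L := hL
  have hk1 : 1 ≤ j + 1 := Nat.le_add_left 1 j
  have hM : 0 < P.mesh (j + 1) := P.mesh_pos _
  -- unfold the family
  dsimp only [regRegionFam] at hregular hepos hele ⊢
  -- the smallness in the (2.23) currency: `e_k^β ≤ E₁`, so `d²·c·e_k^β ≤ 1/3`
  have hecβ : ec ^ β ≤ E₁ := by
    have h1 : ec ^ β ≤ (E₁ ^ (1 / β)) ^ β := Real.rpow_le_rpow hepos.le hele hβ.le
    rw [← Real.rpow_mul hE₁pos.le, one_div_mul_cancel hβ.ne', Real.rpow_one] at h1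
    exact h1
  have hsmall223 : (P.d : ℝ) ^ 2 * c * ec ^ β ≤ 1 / 3 := by
    have hecβ0 : 0 ≤ ec ^ β := (Real.rpow_pos_of_pos hepos β).le
    have h7 : (P.d : ℝ) ^ 2 * c * ec ^ β ≤ ((P.d : ℝ) ^ 2 * c) * (1 / (3 * ((P.d : ℝ) ^ 2 * c + 1))) := by
      rw [← hE₁]; exact mul_le_mul_of_nonneg_left hecβ (by positivity)
    have h8 : ((P.d : ℝ) ^ 2 * c) * (1 / (3 * ((P.d : ℝ) ^ 2 * c + 1))) ≤ 1 / 3 := by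
      rw [mul_one_div, div_le_div_iff₀ (by positivity) (by norm_num)]
      nlinarith [mul_nonneg (sq_nonneg (P.d : ℝ)) hc]
    linarith
  -- the `δ_A`-currency on `Ω₀`, restricted to `Ω`
  set idx : RegRegionIdx P.d P.L := ⟨P, rfl, rfl, j, hk, Λk, Λ0k, hsub, A, ec⟩ with hidx
  obtain ⟨δA, hreg₀, hsmall⟩ := exists_deltaA_of_reg223 C idx.Omega0 A hepos hregular hsmall223
  have hΩΛ : ∀ x, x ∈ idx.Omega ↔ blockIter (j + 1) x ∈ Λk := fun x => idx.mem_Omega x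
  have hΩ₀Λ₀ : ∀ x, x ∈ idx.Omega0 ↔ blockIter (j + 1) x ∈ Λ0k := fun x => idx.mem_Omega0 x
  have hΩsub : idx.Omega ⊆ idx.Omega0 := subset_of_iff hΩΛ hΩ₀Λ₀ hsub
  have hreg : ∀ z ∈ idx.Omega, ∀ μ ν : Fin P.d, |A ⟨z.shift ν, μ⟩ - A ⟨z, μ⟩| ≤ δA := fun z hz => hreg₀ z (hΩsub hz)
  have hδadm : (4 * (P.d : ℝ) + 4 * a) * δa ≤ min 2 (a * (1 - ((P.L : ℝ) ^ 2)⁻¹) / 4) := by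
    rw [hδa]; exact le_of_eq (mul_div_cancel₀ _ hden.ne')
  refine ⟨fun p q => ?_, fun p q => ?_⟩
  · -- (2.27)
    have h := ineq227_regular_region_uniform C ha hPL1 hmsq j hk idx.Omega Λk hΩΛ A hreg hsmall hδapos.le hδadm
      p.1 q.1 p.2 q.2
    have ht : 0 ≤ (HiggsLattice.Site.tdist p.1.1 q.1.1 : ℝ) := Nat.cast_nonneg _
    have hmul := mul_le_mul_of_nonneg_left h (sq_nonneg (P.mesh (j + 1)))
    have e : P.mesh (j + 1) ^ 2 * ((P.mesh (j + 1))⁻¹ ^ 2 *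
        (a + a ^ 2 * (2 / min 2 (a * (1 - ((P.L : ℝ) ^ 2)⁻¹) / 4) * Real.exp δa)) *
          Real.exp (-(δa * (HiggsLattice.Site.tdist p.1.1 q.1.1 : ℝ))))
        = c27 * Real.exp (-(δa * (HiggsLattice.Site.tdist p.1.1 q.1.1 : ℝ))) := by
      rw [hc27]; field_simp
    rw [e] at hmul
    exact hmul.trans (weight_mono (by linarith) (by linarith) (by linarith) ht)
  · -- (2.29)
    have h := ineq229_regular_region_distC C ha hPL1 hmsq j hk idx.Omega idx.Omega0 Λk Λ0k hΩΛ hΩ₀Λ₀ hsub A hreg₀ hsmall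
      hδapos.le hδadm p.1 q.1 p.2 q.2
    have ht : 0 ≤ (HiggsLattice.Site.tdist p.1.1 q.1.1 : ℝ) + distC Λk p.1.1 + distC Λk q.1.1 :=
      add_nonneg (add_nonneg (Nat.cast_nonneg _) (distC_nonneg _ _)) (distC_nonneg _ _)
    have hmul := mul_le_mul_of_nonneg_left h (sq_nonneg (P.mesh (j + 1)))
    have e : P.mesh (j + 1) ^ 2 * (a ^ 2 * ((Real.exp (6 * δa) * ((P.d + a / 2) * (2 / min 2 (a * (1 - ((P.L : ℝ) ^ 2)⁻¹) / 4)) ^ 2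
        + (min 2 (a * (1 - ((P.L : ℝ) ^ 2)⁻¹) / 4))⁻¹)
        + 4 / min 2 (a * (1 - ((P.L : ℝ) ^ 2)⁻¹) / 4) * Real.exp δa) / 2) * ((P.mesh (j + 1))⁻¹ ^ 2) *
          Real.exp (-(δa / 2 * ((HiggsLattice.Site.tdist p.1.1 q.1.1 : ℝ) + distC Λk p.1.1 + distC Λk q.1.1))))
        = cL * Real.exp (-(δa / 2 * ((HiggsLattice.Site.tdist p.1.1 q.1.1 : ℝ) + distC Λk p.1.1 + distC Λk q.1.1))) := by
      rw [hcL]; field_simp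
    rw [e] at hmul
    exact hmul.trans (weight_mono (by linarith) (by linarith) le_rfl ht)

/-- **The family is non-vacuous at every threshold**: for every `e₁ > 0` there is a member with `regular`, `bigBlocks` and `0 < e_k ≤ e₁`
(the torus with `K = M = L′ = 1`, `ε = 1`, level `k = 1`, `Λ_k = Λ⁰_k = T^{(k)}`, `A = 0`, `e_k = e₁`; needs `d ≥ 1`, `L ≥ 1`, `c ≥ 0`).
[cite: Balaban1982Higgs1, (1.2) p.604, (2.23) p.610] -/
theorem regRegionFam_nonvacuous {d L : ℕ} (hd : 1 ≤ d) (hL : 1 ≤ L) (C : ChargeData N) (a msq : ℝ) {c : ℝ} (hc : 0 ≤ c)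
    (β : ℝ) {e₁ : ℝ} (he₁ : 0 < e₁) :
    ∃ i : RegRegionIdx d L,
      (regRegionFam d L C a msq c β i).regular ∧ (regRegionFam d L C a msq c β i).bigBlocks ∧
      0 < (regRegionFam d L C a msq c β i).e ∧ (regRegionFam d L C a msq c β i).e ≤ e₁ := by
  have hL0 : 0 < L := by omega
  refine ⟨⟨⟨d, 1, 1, L, 1, fun _ => 1, hd, one_pos, hL0, one_pos, fun _ => one_pos⟩, rfl, rfl, 0, le_rfl,
    Finset.univ, Finset.univ, le_rfl, 0, e₁⟩, ?_, trivial, he₁, le_rfl⟩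
  dsimp only [regRegionFam]
  intro z _ μ ν
  rw [Pi.zero_apply, Pi.zero_apply, sub_self, abs_zero, mul_zero]
  have : 0 < e₁ ^ (β - 1) := Real.rpow_pos_of_pos he₁ _
  positivity

end Literature.MathematicalPhysics.QuantumFieldTheory.Balaban1983to89.B1Prop22RegularRegionFam

end
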